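import Summits.AtomisticToContinuum.HydrodynamicLimit.Theorems.RelayRaceLocalityNearConstantShortTimeHLAssemblyTheta
import Summits.AtomisticToContinuum.HydrodynamicLimit.Theorems.RelayRaceLocalityNearConstantShortTimeHLSolutionTests
import Summits.AtomisticToContinuum.HydrodynamicLimit.Theorems.RelayRaceLocalityNearConstantShortTimeHLCommutators
import Summits.AtomisticToContinuum.HydrodynamicLimit.Theorems.RelayRaceLocalityNearConstantShortTimeHLEntropyFluxRemainderA
import Literature.MathematicalPhysics.KineticTheory.HardSphereBBGKYLiouvilleFlow
import HarnessLib

/-!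
# Crux `NearConstantShortTimeHL` (stmt-AtomisticToContinuum-12502), line `small-tilt-domination`:
# the trajectory expansion of the log-profile observable (stub `logProfileObs_orbit_expansion`)

Lead c3, wave 2, stub `logProfileObs_orbit_expansion` of the Grönwall assembly.  Along a good hard-sphere
orbit `r ↦ Φ_r z` and over a window `[s, s + τ] ⊆ [0, t]`, the log-profile observable
`X_r = ρ_N[λ⁰_r] + Σⱼ m_N[λ_{r,j}]ⱼ + e_N[λ⁴_r]` (`logProfileObs`) of a classical hard-sphere–Euler solution
satisfies `X_{s+τ} − X_s = ∫_s^{s+τ} ∫ₓ Θ_r(x)(ρ̃, m̃, ẽ) dx dr + momDefect + enDefect + Err`, `|Err| ≤ τ ω (4 + 6 K)`,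
where `Θ` is the entropy-rate density at the ball-averaged empirical fields (`ballRate`), `momDefect` /
`enDefect` are the windowed weak-form closure defects of the momentum / energy rows (carried, not estimated),
`ω` is a modulus of continuity at the ball radius `ℓ` of the four row-derivative fields `∂ₜλ⁰, ∂ₜλ, ∂ₜλ⁴, ∇λ⁰`,
and `K = n⁻¹ Σ ‖vᵢ‖²/2` is the conserved kinetic energy per particle.  Proof:
* the MASS ROW is exact (`densityRow_balance_flow_Ico` on a smoothness horizon `t < t' ≤ T`,
  `exists_horizon_of_packing_lt` + `isSmoothSpaceTimeOn_logProfileRows`): `wc_densityRow`;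
* the MOMENTUM and ENERGY ROWS are, by definition of the defects, `∫ (raw-tested ∂ₜλ + ∫ₓ flux)` plus the
  defect; the window time derivatives `∂ₜ^{[s,s+τ]}` agree with `∂ₜ^{[0,T)}` (`wc_timeDerivWithin_window`);
* pointwise in `r`, `∫ₓ Θ_r(x)(ρ̃, m̃, ẽ) dx` splits into the two flux groups — which ARE the defect flux
  integrands (`wc_entropyRate_split`: `Σₖ ∂ₖλₖ p̃ = p̃ div λ`, `(∇λ⁴)ᵢ = ∂ᵢλ⁴`) — and four linear groups, which
  differ from the raw-tested terms by the commutators of `…Commutators.lean`, of total size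
  `≤ ω (5/2 + 4K) ≤ ω (4 + 6K)` (`wc_linear_commutators`, `wc_avg_speed_le`, energy conservation
  `wc_kineticPP_flow`); then integrate the pointwise bound over the window (`wc_abs_le_of_integrands`).

No definitions, no named facts.  References: H.-T. Yau, Lett. Math. Phys. 22 (1991) §2; H. Spohn, *Large Scale
Dynamics of Interacting Particles* (1991), Part I §3.
-/

noncomputable section

namespace Summit.AtomisticToContinuum.HydrodynamicLimit.Theorems.NearConstantShortTimeHL

open scoped BigOperators ENNReal
open MeasureTheory Set Filter
open Literature.MathematicalPhysics.KineticTheory Literature.Analysis.FluidPDE Literature.Analysis.FunctionSpaces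

/-! ### Elementary pieces -/

/-- **Integration step.** If `R1 − R0 = ∫_s^{s+τ} D` and the four integrands are interval
integrable with `|D + M + E − B| ≤ C` on `(s, s+τ]`, then the telescoped combination of the three
rows minus `∫ B` is at most `τ C` in absolute value (the boundary terms `A1, A0, E1, E0` cancel).
[folklore] -/
theorem wc_abs_le_of_integrands {s τ C R1 R0 : ℝ} (hτ : 0 < τ) {D M E B : ℝ → ℝ}
    (hD : IntervalIntegrable D volume s (s + τ)) (hM : IntervalIntegrable M volume s (s + τ))
    (hE : IntervalIntegrable E volume s (s + τ)) (hB : IntervalIntegrable B volume s (s + τ))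
    (hR : R1 - R0 = ∫ r in s..(s + τ), D r)
    (hpt : ∀ r ∈ Set.Ioc s (s + τ), |D r + M r + E r - B r| ≤ C) (A1 A0 E1 E0 : ℝ) :
    |R1 + A1 + E1 - (R0 + A0 + E0) - (∫ r in s..(s + τ), B r) - (A1 - A0 - ∫ r in s..(s + τ), M r) -
        (E1 - E0 - ∫ r in s..(s + τ), E r)| ≤ τ * C := by
  have hsτ : s ≤ s + τ := by linarith
  have hsum : ∫ r in s..(s + τ), (D r + M r + E r - B r) =
      (∫ r in s..(s + τ), D r) + (∫ r in s..(s + τ), M r) + (∫ r in s..(s + τ), E r) -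
        ∫ r in s..(s + τ), B r := by
    rw [intervalIntegral.integral_sub ((hD.add hM).add hE) hB, intervalIntegral.integral_add (hD.add hM) hE,
      intervalIntegral.integral_add hD hM]
  have e : R1 + A1 + E1 - (R0 + A0 + E0) - (∫ r in s..(s + τ), B r) - (A1 - A0 - ∫ r in s..(s + τ), M r) -
      (E1 - E0 - ∫ r in s..(s + τ), E r) = ∫ r in s..(s + τ), (D r + M r + E r - B r) := by
    rw [hsum]; linear_combination hR
  rw [e]
  have h := intervalIntegral.norm_integral_le_of_norm_le_const (a := s) (b := s + τ) (C := C)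
    (f := fun r => D r + M r + E r - B r) fun r hr => by
      rw [Real.norm_eq_abs]; exact hpt r (by rwa [uIoc_of_le hsτ] at hr)
  rw [Real.norm_eq_abs, add_sub_cancel_left, abs_of_pos hτ] at h
  linarith [h]

/-- **Window time derivatives.** For a field jointly smooth on `[0, t') × 𝕋³` and a window
`[s, s+τ]`, `0 ≤ s`, `s + τ < t' ≤ T`, the one-sided time derivative within the window agrees with
the one within `[0, T)` (`timeDerivWithin_Icc_eq_of_isSmoothSpaceTimeOn` at horizon `t'`, then
`timeDerivWithin_Ico_eq_of_le`). [folklore] -/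
theorem wc_timeDerivWithin_window {F' : Type*} [NormedAddCommGroup F'] [NormedSpace ℝ F']
    {T t' s τ : ℝ} {f : ℝ → T3 → F'} (hf : Torus.IsSmoothSpaceTimeOn (Set.Ico 0 t') f) (hs : 0 ≤ s)
    (hτ : 0 < τ) (hst' : s + τ < t') (ht' : t' ≤ T) {r : ℝ} (hr : r ∈ Set.Icc s (s + τ)) (x : T3) :
    Torus.timeDerivWithin (Set.Icc s (s + τ)) f r x = Torus.timeDerivWithin (Set.Ico 0 T) f r x := by
  rw [timeDerivWithin_Icc_eq_of_isSmoothSpaceTimeOn hf hs (by linarith) hst' hr x]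
  exact timeDerivWithin_Ico_eq_of_le ht' f ⟨hs.trans hr.1, hr.2.trans_lt hst'⟩ x

/-- **Continuity of the time-derivative slices.** For a field jointly smooth on `[0, t') × 𝕋³`,
`t' ≤ T`, and `r ∈ [0, t')`, the slice `x ↦ ∂ₜ^{[0,T)} f (r, x)` is continuous (it is the slice of
the jointly smooth field `∂ₜ^{[0,t')} f`). [folklore] -/
theorem wc_continuous_timeDerivWithin {F' : Type*} [NormedAddCommGroup F'] [NormedSpace ℝ F']
    {T t' : ℝ} {f : ℝ → T3 → F'} (hf : Torus.IsSmoothSpaceTimeOn (Set.Ico 0 t') f) (ht' : t' ≤ T) {r : ℝ}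
    (hr : r ∈ Set.Ico 0 t') : Continuous (Torus.timeDerivWithin (Set.Ico 0 T) f r) := by
  have h : Continuous (Torus.timeDerivWithin (Set.Ico 0 t') f r) :=
    ((hf.timeDerivWithin (uniqueDiffOn_Ico 0 t')).isSmooth_slice hr).continuous
  have heq : Torus.timeDerivWithin (Set.Ico 0 T) f r = Torus.timeDerivWithin (Set.Ico 0 t') f r :=
    funext fun x => (timeDerivWithin_Ico_eq_of_le ht' f hr x).symm
  rwa [heq]

/-- **The mass row along the orbit, normalised.** For a scalar test `φ` jointly smooth on
`[0, t') × 𝕋³`, `t' ≤ T`, and a window `0 ≤ a ≤ b < t'`: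
`ρ_{Φ_b z}[φ_b] − ρ_{Φ_a z}[φ_a] = ∫_a^b n⁻¹ Σᵢ (∂ₜ^{[0,T)}φ + vᵢ·∇φ)(r, xᵢ(r)) dr`, with an interval
integrable integrand (`densityRow_balance_flow_Ico` at horizon `t'`, derivatives moved to `[0, T)`
by `timeDerivWithin_Ico_eq_of_le`). [cite: Serre2024, §5 (16)] -/
theorem wc_densityRow {ε : ℝ} {n : ℕ} (Φ : HardSphereFlow (Torus.geometry (Fin 3)) ε n)
    {z : Config n (Fin 3) T3} (hz : z ∈ Φ.good) {T t' : ℝ} (ht' : t' ≤ T) {φ : ℝ → T3 → ℝ}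
    (hφ : Torus.IsSmoothSpaceTimeOn (Set.Ico 0 t') φ) {a b : ℝ} (ha : 0 ≤ a) (hab : a ≤ b) (hb : b < t') :
    IntervalIntegrable (fun r => (n : ℝ)⁻¹ * ∑ i, (Torus.timeDerivWithin (Set.Ico 0 T) φ r ((Φ.flow r z) i).1 +
        ∑ k, Torus.partialDeriv k (φ r) ((Φ.flow r z) i).1 * ((Φ.flow r z) i).2 k)) volume a b ∧
    empiricalDensityField (Φ.flow b z) (φ b) - empiricalDensityField (Φ.flow a z) (φ a) =
      ∫ r in a..b, (n : ℝ)⁻¹ * ∑ i, (Torus.timeDerivWithin (Set.Ico 0 T) φ r ((Φ.flow r z) i).1 +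
        ∑ k, Torus.partialDeriv k (φ r) ((Φ.flow r z) i).1 * ((Φ.flow r z) i).2 k) := by
  obtain ⟨hint, heq⟩ := densityRow_balance_flow_Ico Φ hz hφ ha hab hb
  have hagree : EqOn
      (fun r => ∑ i, (Torus.timeDerivWithin (Set.Ico 0 t') φ r ((Φ.flow r z) i).1 +
        ∑ k, Torus.partialDeriv k (φ r) ((Φ.flow r z) i).1 * ((Φ.flow r z) i).2 k))
      (fun r => ∑ i, (Torus.timeDerivWithin (Set.Ico 0 T) φ r ((Φ.flow r z) i).1 +
        ∑ k, Torus.partialDeriv k (φ r) ((Φ.flow r z) i).1 * ((Φ.flow r z) i).2 k)) (Set.Icc a b) := by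
    intro r hr
    have hr' : r ∈ Set.Ico 0 t' := ⟨ha.trans hr.1, hr.2.trans_lt hb⟩
    exact Finset.sum_congr rfl fun i _ => by rw [timeDerivWithin_Ico_eq_of_le ht' φ hr']
  have hint' : IntervalIntegrable (fun r => ∑ i, (Torus.timeDerivWithin (Set.Ico 0 T) φ r ((Φ.flow r z) i).1 +
      ∑ k, Torus.partialDeriv k (φ r) ((Φ.flow r z) i).1 * ((Φ.flow r z) i).2 k)) volume a b := by
    rw [intervalIntegrable_iff_integrableOn_Ioc_of_le hab] at hint ⊢
    exact hint.congr_fun (hagree.mono Ioc_subset_Icc_self) measurableSet_Ioc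
  have heq' : (∫ r in a..b, ∑ i, (Torus.timeDerivWithin (Set.Ico 0 t') φ r ((Φ.flow r z) i).1 +
        ∑ k, Torus.partialDeriv k (φ r) ((Φ.flow r z) i).1 * ((Φ.flow r z) i).2 k)) =
      ∫ r in a..b, ∑ i, (Torus.timeDerivWithin (Set.Ico 0 T) φ r ((Φ.flow r z) i).1 +
        ∑ k, Torus.partialDeriv k (φ r) ((Φ.flow r z) i).1 * ((Φ.flow r z) i).2 k) :=
    intervalIntegral.integral_congr fun r hr => hagree (by rw [uIcc_of_le hab] at hr; exact hr)
  refine ⟨hint'.const_mul _, ?_⟩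
  rw [intervalIntegral.integral_const_mul, ← heq', ← heq, empiricalDensityField_eq_sum,
    empiricalDensityField_eq_sum, mul_sub]

/-- The normalised mass-row integrand in empirical-field form:
`n⁻¹ Σᵢ (a(xᵢ) + Σₖ bₖ(xᵢ) vᵢₖ) = ρ_w[a] + Σₖ (m_w[bₖ])ₖ`. [folklore] -/
theorem wc_density_integrand_eq {n : ℕ} (w : Config n (Fin 3) T3) (a : T3 → ℝ) (b : Fin 3 → T3 → ℝ) :
    (n : ℝ)⁻¹ * ∑ i, (a (w i).1 + ∑ k, b k (w i).1 * (w i).2 k) =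
      empiricalDensityField w a + ∑ k, (empiricalMomentumField w (b k)) k := by
  rw [empiricalDensityField_eq_sum]
  simp_rw [empiricalMomentumField_apply_eq_sum]
  rw [Finset.sum_add_distrib, mul_add, ← Finset.mul_sum, Finset.sum_comm]

/-- **Energy conservation** for the kinetic energy per particle: `K(Φ_r z) = K(z)` on the good set
(`HardSphereFlow.configEnergy_flow`; `K = n⁻¹ · configEnergy`). [cite: GST2013, §1.1] -/
theorem wc_kineticPP_flow {ε : ℝ} {n : ℕ} (Φ : HardSphereFlow (Torus.geometry (Fin 3)) ε n)
    {z : Config n (Fin 3) T3} (hz : z ∈ Φ.good) (r : ℝ) : kineticPP (Φ.flow r z) = kineticPP z := by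
  have e : ∀ w : Config n (Fin 3) T3, kineticPP w = (n : ℝ)⁻¹ * configEnergy w := fun w => by
    unfold kineticPP configEnergy
    congr 1; rw [Finset.mul_sum]; exact Finset.sum_congr rfl fun i _ => by ring
  rw [e, e, Φ.configEnergy_flow hz r]

/-- The mean speed is controlled by the kinetic energy per particle: `n⁻¹ Σᵢ ‖vᵢ‖ ≤ 1/2 + K(w)`
(`‖v‖ ≤ 1/2 + ‖v‖²/2`), `n ≥ 1`. [folklore] -/
theorem wc_avg_speed_le {n : ℕ} (hn : n ≠ 0) (w : Config n (Fin 3) T3) :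
    (n : ℝ)⁻¹ * ∑ i, ‖(w i).2‖ ≤ 1 / 2 + kineticPP w := by
  unfold kineticPP
  have h : ∀ i, ‖(w i).2‖ ≤ 1 / 2 + ‖(w i).2‖ ^ 2 / 2 := fun i => by nlinarith [sq_nonneg (‖(w i).2‖ - 1)]
  have hs : ∑ i, ‖(w i).2‖ ≤ ∑ i : Fin n, ((1 : ℝ) / 2 + ‖(w i).2‖ ^ 2 / 2) :=
    Finset.sum_le_sum fun i _ => h i
  rw [Finset.sum_add_distrib, Finset.sum_const, Finset.card_univ, Fintype.card_fin, nsmul_eq_mul] at hs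
  have hn' : (0 : ℝ) < n := Nat.cast_pos.2 (Nat.pos_of_ne_zero hn)
  calc (n : ℝ)⁻¹ * ∑ i, ‖(w i).2‖ ≤ (n : ℝ)⁻¹ * (n * (1 / 2) + ∑ i, ‖(w i).2‖ ^ 2 / 2) :=
        mul_le_mul_of_nonneg_left hs (inv_nonneg.2 hn'.le)
    _ = 1 / 2 + (n : ℝ)⁻¹ * ∑ i, ‖(w i).2‖ ^ 2 / 2 := by
        rw [mul_add, ← mul_assoc, inv_mul_cancel₀ hn'.ne', one_mul]

/-- Sup-norm to Euclidean norm in `ℝ³`: coordinates bounded by `ω ≥ 0` give norm `≤ 2ω`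
(`√3 ≤ 2`). [folklore] -/
theorem wc_norm_toLp_le {ω : ℝ} (hω : 0 ≤ ω) {a : Fin 3 → ℝ} (ha : ∀ k, |a k| ≤ ω) :
    ‖(WithLp.toLp 2 a : V3)‖ ≤ 2 * ω := by
  rw [EuclideanSpace.norm_eq]
  have hsum : ∑ k, ‖(WithLp.toLp 2 a : V3) k‖ ^ 2 ≤ (2 * ω) ^ 2 := by
    have hk : ∀ k, ‖(WithLp.toLp 2 a : V3) k‖ ^ 2 ≤ ω ^ 2 := fun k => by
      rw [PiLp.toLp_apply, Real.norm_eq_abs]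
      exact pow_le_pow_left₀ (abs_nonneg _) (ha k) 2
    calc ∑ k, ‖(WithLp.toLp 2 a : V3) k‖ ^ 2 ≤ ∑ _k : Fin 3, ω ^ 2 := Finset.sum_le_sum fun k _ => hk k
      _ = 3 * ω ^ 2 := by simp
      _ ≤ (2 * ω) ^ 2 := by nlinarith [sq_nonneg ω]
  calc Real.sqrt (∑ k, ‖(WithLp.toLp 2 a : V3) k‖ ^ 2) ≤ Real.sqrt ((2 * ω) ^ 2) := Real.sqrt_le_sqrt hsum
    _ = 2 * ω := Real.sqrt_sq (by linarith)

/-! ### The flux algebra and the linear commutators -/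

/-- **Splitting the entropy-rate density.** For `C¹` slices `λ_r`, `λ⁴_r`, the entropy-rate
density `Θ_r(x)(ρ', m', E')` is the sum of its four LINEAR groups `∂ₜλ⁰ ρ' + Σⱼ ∂ₜλⱼ m'ⱼ + ∂ₜλ⁴ E' +
Σₖ ∂ₖλ⁰ m'ₖ` and the two FLUX groups written exactly as the integrands of `momDefect` / `enDefect`:
`ΣₖΣⱼ ∂ₖλⱼ m'ₖm'ⱼ/ρ' + p' div λ` (`Σₖ (∂ₖλ)ₖ = div λ`, `Torus.partialDeriv_apply_coord`) and
`(E' + p') Σᵢ (m'ᵢ/ρ') (∇λ⁴)ᵢ` (`(∇λ⁴)ᵢ = ∂ᵢλ⁴`), `p' = hsPressure σ ρ' θ(W)`. [cite: Yau1991, §2] -/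
theorem wc_entropyRate_split {σ T : ℝ} {ρ θ : ℝ → T3 → ℝ} {u : ℝ → T3 → V3} {r : ℝ}
    (h1 : Torus.IsContDiff 1 (lamRow θ u r)) (h4 : Torus.IsContDiff 1 (lam4Row θ r)) (x : T3) (ρ' E' : ℝ)
    (m' : V3) :
    entropyRate σ T ρ θ u r x ρ' E' m' =
      Torus.timeDerivWithin (Set.Ico 0 T) (lam0Row σ ρ θ u) r x * ρ' +
      (∑ j, Torus.timeDerivWithin (Set.Ico 0 T) (lamRow θ u) r x j * m' j) +
      Torus.timeDerivWithin (Set.Ico 0 T) (lam4Row θ) r x * E' +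
      (∑ k, Torus.partialDeriv k (lam0Row σ ρ θ u r) x * m' k) +
      ((∑ i, ∑ j, (Torus.partialDeriv i (lamRow θ u r) x) j * (m' i * m' j / ρ')) +
        hsPressure σ ρ' (2 / 3 * (E' / ρ' - ‖m'‖ ^ 2 / (2 * ρ' ^ 2))) * Torus.divergence (lamRow θ u r) x) +
      (E' + hsPressure σ ρ' (2 / 3 * (E' / ρ' - ‖m'‖ ^ 2 / (2 * ρ' ^ 2)))) *
        (∑ i, (m' i / ρ') * (Torus.gradient (lam4Row θ r) x) i) := by
  have hdiv : Torus.divergence (lamRow θ u r) x = ∑ k, Torus.partialDeriv k (lamRow θ u r) x k :=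
    Finset.sum_congr rfl fun k _ => Torus.partialDeriv_apply_coord h1 k x k
  have hgrad : ∀ i, Torus.gradient (lam4Row θ r) x i = Torus.partialDeriv i (lam4Row θ r) x := fun i =>
    HsEulerCalc.gradient_apply_eq_partialDeriv h4 x i
  have hM : ∀ P : ℝ, (∑ k, ∑ j, Torus.partialDeriv k (lamRow θ u r) x j *
      (m' k * m' j / ρ' + if k = j then P else 0)) =
      (∑ k, ∑ j, Torus.partialDeriv k (lamRow θ u r) x j * (m' k * m' j / ρ')) +
        P * Torus.divergence (lamRow θ u r) x := fun P => by
    rw [hdiv, Finset.mul_sum, ← Finset.sum_add_distrib]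
    refine Finset.sum_congr rfl fun k _ => ?_
    simp only [mul_add, Finset.sum_add_distrib, mul_ite, mul_zero, Finset.sum_ite_eq, Finset.mem_univ,
      if_true]
    ring
  have hE : ∀ Q : ℝ, (∑ k, Torus.partialDeriv k (lam4Row θ r) x * (Q * m' k / ρ')) =
      Q * ∑ i, (m' i / ρ') * (Torus.gradient (lam4Row θ r) x) i := fun Q => by
    rw [Finset.mul_sum]
    exact Finset.sum_congr rfl fun k _ => by rw [hgrad]; ring
  unfold entropyRate stateTemp
  rw [hM, hE]

/-- **The four linear commutators, summed.** For `n ≥ 1` particles, `0 < ℓ < 1/2`, continuous tests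
`f₁, G, f₃, (gₖ)ₖ` with modulus `ω ≥ 0` at scale `ℓ` (norm modulus for the vector test `G`,
coordinatewise for `g`), and any integrable `P, Q` (the flux integrands, which cancel):
`|ρ_w[f₁] + Σₖ(m_w[gₖ])ₖ + (Σⱼ(m_w[Gⱼ])ⱼ + ∫P) + (e_w[f₃] + ∫Q) − ∫(f₁ρ̃ + ΣⱼGⱼm̃ⱼ + f₃ẽ + Σₖgₖm̃ₖ + P + Q)|
≤ ω + 2ω A + ω A + ω K ≤ ω (4 + 6K)`, `A = n⁻¹Σ‖vᵢ‖ ≤ 1/2 + K` (commutators of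
`…Commutators.lean`; the vector `(gₖ)ₖ` has norm modulus `≤ 2ω`). [folklore] -/
theorem wc_linear_commutators {n : ℕ} (hn : n ≠ 0) {ℓ : ℝ} (hℓ0 : 0 < ℓ) (hℓ : ℓ < 1 / 2) {ω : ℝ} (hω : 0 ≤ ω)
    {f₁ f₃ : T3 → ℝ} {G : T3 → V3} {g : Fin 3 → T3 → ℝ}
    (hf₁ : Continuous f₁) (hG : Continuous G) (hf₃ : Continuous f₃) (hg : ∀ k, Continuous (g k))
    (hm₁ : ∀ x y : T3, Torus.euclidDist x y < ℓ → |f₁ x - f₁ y| ≤ ω)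
    (hmG : ∀ x y : T3, Torus.euclidDist x y < ℓ → ‖G x - G y‖ ≤ ω)
    (hm₃ : ∀ x y : T3, Torus.euclidDist x y < ℓ → |f₃ x - f₃ y| ≤ ω)
    (hmg : ∀ k, ∀ x y : T3, Torus.euclidDist x y < ℓ → |g k x - g k y| ≤ ω)
    (w : Config n (Fin 3) T3) {P Q : T3 → ℝ} (hP : Integrable P) (hQ : Integrable Q) :
    |empiricalDensityField w f₁ + (∑ k, (empiricalMomentumField w (g k)) k) +
        ((∑ j, (empiricalMomentumField w (fun y => G y j)) j) + ∫ x, P x) +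
        (empiricalEnergyField w f₃ + ∫ x, Q x) -
      ∫ x, (f₁ x * empiricalDensityField w (ballKernel ℓ x) +
        (∑ j, G x j * (empiricalMomentumField w (ballKernel ℓ x)) j) +
        f₃ x * empiricalEnergyField w (ballKernel ℓ x) +
        (∑ k, g k x * (empiricalMomentumField w (ballKernel ℓ x)) k) + P x + Q x)| ≤
      ω * (4 + 6 * kineticPP w) := by
  have i1 : Integrable (fun x => f₁ x * empiricalDensityField w (ballKernel ℓ x)) :=
    integrable_mul_ballDensity ℓ hf₁ w
  have i2 : Integrable (fun x => ∑ j, G x j * (empiricalMomentumField w (ballKernel ℓ x)) j) :=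
    integrable_finsetSum _ fun j _ =>
      integrable_mul_ballMomentum_apply ℓ ((PiLp.continuous_apply 2 _ j).comp hG) w j
  have i3 : Integrable (fun x => f₃ x * empiricalEnergyField w (ballKernel ℓ x)) :=
    integrable_mul_ballEnergy ℓ hf₃ w
  have i4 : Integrable (fun x => ∑ k, g k x * (empiricalMomentumField w (ballKernel ℓ x)) k) :=
    integrable_finsetSum _ fun k _ => integrable_mul_ballMomentum_apply ℓ (hg k) w k
  have i12 : Integrable (fun x => f₁ x * empiricalDensityField w (ballKernel ℓ x) +
      ∑ j, G x j * (empiricalMomentumField w (ballKernel ℓ x)) j) := i1.add i2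
  have i123 : Integrable (fun x => f₁ x * empiricalDensityField w (ballKernel ℓ x) +
      (∑ j, G x j * (empiricalMomentumField w (ballKernel ℓ x)) j) +
      f₃ x * empiricalEnergyField w (ballKernel ℓ x)) := i12.add i3
  have i1234 : Integrable (fun x => f₁ x * empiricalDensityField w (ballKernel ℓ x) +
      (∑ j, G x j * (empiricalMomentumField w (ballKernel ℓ x)) j) +
      f₃ x * empiricalEnergyField w (ballKernel ℓ x) +
      (∑ k, g k x * (empiricalMomentumField w (ballKernel ℓ x)) k)) := i123.add i4
  have iP : Integrable (fun x => f₁ x * empiricalDensityField w (ballKernel ℓ x) +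
      (∑ j, G x j * (empiricalMomentumField w (ballKernel ℓ x)) j) +
      f₃ x * empiricalEnergyField w (ballKernel ℓ x) +
      (∑ k, g k x * (empiricalMomentumField w (ballKernel ℓ x)) k) + P x) := i1234.add hP
  rw [integral_add iP hQ, integral_add i1234 hP, integral_add i123 i4, integral_add i12 i3, integral_add i1 i2]
  have b1 := abs_empiricalDensityField_sub_integral_ball_le hn hℓ0 hℓ hf₁ hm₁ w
  have b2 := abs_sum_empiricalMomentumField_sub_integral_ball_le hℓ0 hℓ hG hmG w
  have b3 : |empiricalEnergyField w f₃ - ∫ x, f₃ x * empiricalEnergyField w (ballKernel ℓ x)| ≤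
      ω * kineticPP w := abs_empiricalEnergyField_sub_integral_ball_le hℓ0 hℓ hf₃ hm₃ w
  have hg'c : Continuous fun y : T3 => (WithLp.toLp 2 fun k => g k y : V3) :=
    (PiLp.continuous_toLp 2 _).comp (continuous_pi fun k => hg k)
  have hg'm : ∀ x y : T3, Torus.euclidDist x y < ℓ →
      ‖(WithLp.toLp 2 fun k => g k x : V3) - WithLp.toLp 2 (fun k => g k y)‖ ≤ 2 * ω := fun x y hxy => by
    rw [← WithLp.toLp_sub]
    exact wc_norm_toLp_le hω fun k => hmg k x y hxy
  have b4 := abs_sum_empiricalMomentumField_sub_integral_ball_le hℓ0 hℓ hg'c hg'm w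
  dsimp only at b4
  have hA := wc_avg_speed_le hn w
  have hK : 0 ≤ kineticPP w := by unfold kineticPP; positivity
  have hωA : ω * ((n : ℝ)⁻¹ * ∑ i, ‖(w i).2‖) ≤ ω * (1 / 2 + kineticPP w) := mul_le_mul_of_nonneg_left hA hω
  have hωK : 0 ≤ ω * kineticPP w := mul_nonneg hω hK
  obtain ⟨⟨b1l, b1r⟩, ⟨b2l, b2r⟩⟩ := And.intro (abs_le.1 b1) (abs_le.1 b2)
  obtain ⟨⟨b3l, b3r⟩, ⟨b4l, b4r⟩⟩ := And.intro (abs_le.1 b3) (abs_le.1 b4)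
  exact abs_le.2 ⟨by linarith, by linarith⟩

/-! ### The expansion -/

/-- **Core of the trajectory expansion.** Given a smoothness horizon `t'` for the three rows
(`s + τ < t' ≤ T`), the modulus hypothesis, ANY functions `MF, EF` through which the ball rate
splits as "four linear groups `+ MF + EF`" on the window, and the interval/space integrability of
the momentum and energy rows and of `∫ₓ ballRate`, the telescoped three-row combination is within
`τ ω (4 + 6K)` of `∫∫ ballRate` — uniformly in the boundary terms `A1, A0, E1, E0` (they cancel
against the defects). Mass row: `wc_densityRow`; pointwise in `r`: `wc_linear_commutators` with the
window derivatives moved to `[0, T)` and `K(Φ_r z) = K(z)`. [cite: Yau1991, §2] -/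
theorem wc_core {σ T : ℝ} {ρ θ : ℝ → T3 → ℝ} {u : ℝ → T3 → V3} {ε : ℝ} {n : ℕ}
    (Φ : HardSphereFlow (Torus.geometry (Fin 3)) ε n) {z : Config n (Fin 3) T3} (hz : z ∈ Φ.good) (hn : n ≠ 0)
    {s τ t' : ℝ} (hs : 0 ≤ s) (hτ : 0 < τ) (hst' : s + τ < t') (ht'T : t' ≤ T)
    (h0 : Torus.IsSmoothSpaceTimeOn (Set.Ico 0 t') (lam0Row σ ρ θ u))
    (h1 : Torus.IsSmoothSpaceTimeOn (Set.Ico 0 t') (lamRow θ u))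
    (h4 : Torus.IsSmoothSpaceTimeOn (Set.Ico 0 t') (lam4Row θ))
    {ℓ : ℝ} (hℓ0 : 0 < ℓ) (hℓ : ℓ < 1 / 2) {ω : ℝ} (hω : 0 ≤ ω)
    (hmod : ∀ r ∈ Set.Icc s (s + τ), ∀ x y : T3, Torus.euclidDist x y < ℓ →
      |Torus.timeDerivWithin (Set.Ico 0 T) (lam0Row σ ρ θ u) r x -
          Torus.timeDerivWithin (Set.Ico 0 T) (lam0Row σ ρ θ u) r y| ≤ ω ∧
        ‖Torus.timeDerivWithin (Set.Ico 0 T) (lamRow θ u) r x -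
          Torus.timeDerivWithin (Set.Ico 0 T) (lamRow θ u) r y‖ ≤ ω ∧
        |Torus.timeDerivWithin (Set.Ico 0 T) (lam4Row θ) r x -
          Torus.timeDerivWithin (Set.Ico 0 T) (lam4Row θ) r y| ≤ ω ∧
        ∀ k, |Torus.partialDeriv k (lam0Row σ ρ θ u r) x - Torus.partialDeriv k (lam0Row σ ρ θ u r) y| ≤ ω)
    (MF EF : ℝ → T3 → ℝ)
    (hsplit : ∀ r ∈ Set.Icc s (s + τ), ∀ x, ballRate σ T ρ θ u r ℓ (Φ.flow r z) x =
      Torus.timeDerivWithin (Set.Ico 0 T) (lam0Row σ ρ θ u) r x *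
          empiricalDensityField (Φ.flow r z) (ballKernel ℓ x) +
        (∑ j, Torus.timeDerivWithin (Set.Ico 0 T) (lamRow θ u) r x j *
          (empiricalMomentumField (Φ.flow r z) (ballKernel ℓ x)) j) +
        Torus.timeDerivWithin (Set.Ico 0 T) (lam4Row θ) r x * empiricalEnergyField (Φ.flow r z) (ballKernel ℓ x) +
        (∑ k, Torus.partialDeriv k (lam0Row σ ρ θ u r) x * (empiricalMomentumField (Φ.flow r z) (ballKernel ℓ x)) k) +
        MF r x + EF r x)
    (hIM : IntervalIntegrable (fun r => (∑ j, (empiricalMomentumField (Φ.flow r z)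
      (fun y => Torus.timeDerivWithin (Set.Icc s (s + τ)) (lamRow θ u) r y j)) j) + ∫ x, MF r x) volume s (s + τ))
    (hMF : ∀ r ∈ Set.Icc s (s + τ), Integrable (fun x => MF r x))
    (hIE : IntervalIntegrable (fun r => empiricalEnergyField (Φ.flow r z)
      (Torus.timeDerivWithin (Set.Icc s (s + τ)) (lam4Row θ) r) + ∫ x, EF r x) volume s (s + τ))
    (hEF : ∀ r ∈ Set.Icc s (s + τ), Integrable (fun x => EF r x))
    (hIB : IntervalIntegrable (fun r => ∫ x, ballRate σ T ρ θ u r ℓ (Φ.flow r z) x) volume s (s + τ))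
    (A1 A0 E1 E0 : ℝ) :
    |empiricalDensityField (Φ.flow (s + τ) z) (lam0Row σ ρ θ u (s + τ)) + A1 + E1 -
        (empiricalDensityField (Φ.flow s z) (lam0Row σ ρ θ u s) + A0 + E0) -
        (∫ r in s..(s + τ), ∫ x, ballRate σ T ρ θ u r ℓ (Φ.flow r z) x) -
        (A1 - A0 - ∫ r in s..(s + τ), ((∑ j, (empiricalMomentumField (Φ.flow r z)
          (fun y => Torus.timeDerivWithin (Set.Icc s (s + τ)) (lamRow θ u) r y j)) j) + ∫ x, MF r x)) -
        (E1 - E0 - ∫ r in s..(s + τ), (empiricalEnergyField (Φ.flow r z)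
          (Torus.timeDerivWithin (Set.Icc s (s + τ)) (lam4Row θ) r) + ∫ x, EF r x))| ≤
      τ * ω * (4 + 6 * kineticPP z) := by
  obtain ⟨hDint, hDeq⟩ := wc_densityRow Φ hz ht'T h0 hs (by linarith : s ≤ s + τ) hst'
  rw [mul_assoc]
  refine wc_abs_le_of_integrands (C := ω * (4 + 6 * kineticPP z)) hτ hDint hIM hIE hIB hDeq ?_ A1 A0 E1 E0
  intro r hr
  dsimp only
  have hrI : r ∈ Set.Icc s (s + τ) := ⟨hr.1.le, hr.2⟩
  have hr0 : r ∈ Set.Ico 0 t' := ⟨hs.trans hr.1.le, hr.2.trans_lt hst'⟩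
  have hc1 : (∑ j, (empiricalMomentumField (Φ.flow r z)
      (fun y => Torus.timeDerivWithin (Set.Icc s (s + τ)) (lamRow θ u) r y j)) j) =
      ∑ j, (empiricalMomentumField (Φ.flow r z)
        (fun y => Torus.timeDerivWithin (Set.Ico 0 T) (lamRow θ u) r y j)) j :=
    Finset.sum_congr rfl fun j _ => by
      rw [show (fun y => Torus.timeDerivWithin (Set.Icc s (s + τ)) (lamRow θ u) r y j) =
          fun y => Torus.timeDerivWithin (Set.Ico 0 T) (lamRow θ u) r y j from
        funext fun y => by rw [wc_timeDerivWithin_window h1 hs hτ hst' ht'T hrI y]]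
  have hc4 : Torus.timeDerivWithin (Set.Icc s (s + τ)) (lam4Row θ) r =
      Torus.timeDerivWithin (Set.Ico 0 T) (lam4Row θ) r :=
    funext fun y => wc_timeDerivWithin_window h4 hs hτ hst' ht'T hrI y
  have hf₁c : Continuous (Torus.timeDerivWithin (Set.Ico 0 T) (lam0Row σ ρ θ u) r) :=
    wc_continuous_timeDerivWithin h0 ht'T hr0
  have hGc : Continuous (Torus.timeDerivWithin (Set.Ico 0 T) (lamRow θ u) r) :=
    wc_continuous_timeDerivWithin h1 ht'T hr0
  have hf₃c : Continuous (Torus.timeDerivWithin (Set.Ico 0 T) (lam4Row θ) r) :=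
    wc_continuous_timeDerivWithin h4 ht'T hr0
  have hgc : ∀ k, Continuous (Torus.partialDeriv k (lam0Row σ ρ θ u r)) := fun k =>
    ((h0.isSmooth_slice hr0).partialDeriv k).continuous
  rw [wc_density_integrand_eq, hc1, hc4, ← wc_kineticPP_flow Φ hz r]
  simp only [hsplit r hrI]
  exact wc_linear_commutators hn hℓ0 hℓ hω hf₁c hGc hf₃c hgc (fun x y h => (hmod r hrI x y h).1)
    (fun x y h => (hmod r hrI x y h).2.1) (fun x y h => (hmod r hrI x y h).2.2.1)
    (fun k x y h => (hmod r hrI x y h).2.2.2 k) (Φ.flow r z) (hMF r hrI) (hEF r hrI)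

/-- **Registered stub `logProfileObs_orbit_expansion`: the trajectory expansion of the log-profile
observable along a hard-sphere orbit over a window.**  For a classical hard-sphere–Euler solution in
the analyticity band on `[0, t]`, a good orbit, a window `[s, s+τ] ⊆ [0, t]`, a ball radius
`0 < ℓ < 1/2` and a modulus `ω` of the four row-derivative fields at scale `ℓ` on the window:
`|X_{s+τ}(Φ_{s+τ}z) − X_s(Φ_s z) − ∫_s^{s+τ}∫ₓ ballRate − momDefect − enDefect| ≤ τ ω (4 + 6 K(z))`,
under the stated integrability hypotheses (mass row exact, momentum/energy rows through the closure
defects, raw-vs-ball-average commutators as the only error).  Proof: smoothness horizon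
(`exists_horizon_of_packing_lt`, `isSmoothSpaceTimeOn_logProfileRows`), the split of the ball rate
(`wc_entropyRate_split`, whose flux groups are by `rfl` the `let`-bound `MF`, `EF`), and `wc_core`
(the defects and `logProfileObs` unfold definitionally). [cite: Yau1991, §2] -/
theorem logProfileObs_orbit_expansion : ∀ {η₀ : ℝ} {F : ℝ → ℝ}, 0 < η₀ → AnalyticOnNhd ℝ F (Set.Ioo (-η₀) η₀) → Set.EqOn hsExcessFreeEnergy F (Set.Ico 0 η₀) → ∀ {σ T : ℝ}, 0 < σ → ∀ {ρ θ : ℝ → T3 → ℝ} {u : ℝ → T3 → V3}, IsHardSphereEulerSolution σ T ρ u θ → ∀ {t : ℝ}, t ∈ Set.Ico 0 T → (∀ s ∈ Set.Icc 0 t, ∀ x, ρ s x * σ ^ 3 < η₀) → ∀ {ε : ℝ} {n : ℕ} (Φ : HardSphereFlow (Torus.geometry (Fin 3)) ε n) {z : Config n (Fin 3) T3}, z ∈ Φ.good → n ≠ 0 → ∀ {s τ : ℝ}, 0 ≤ s → 0 < τ → s + τ ≤ t → ∀ {ℓ : ℝ}, 0 < ℓ → ℓ < 1 / 2 → ∀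 {ω : ℝ}, 0 ≤ ω → (∀ r ∈ Set.Icc s (s + τ), ∀ x y : T3, Torus.euclidDist x y < ℓ → |Torus.timeDerivWithin (Set.Ico 0 T) (lam0Row σ ρ θ u) r x - Torus.timeDerivWithin (Set.Ico 0 T) (lam0Row σ ρ θ u) r y| ≤ ω ∧ ‖Torus.timeDerivWithin (Set.Ico 0 T) (lamRow θ u) r x - Torus.timeDerivWithin (Set.Ico 0 T) (lamRow θ u) r y‖ ≤ ω ∧ |Torus.timeDerivWithin (Set.Ico 0 T) (lam4Row θ) r x - Torus.timeDerivWithin (Set.Ico 0 T) (lam4Row θ) r y| ≤ ω ∧ ∀ k, |Torus.partialDeriv k (lam0Row σ ρ θ u r) x - Torus.partialDeriv k (lam0Row σ ρ θ u r) y| ≤ ω) → let ρt : ℝ → T3 → ℝ := fun r x => empiricalDensityField (Φ.flow r z) (ballKernel ℓ x); let mt : ℝ → T3 → V3 := fun r x => empiricalMomentumField (Φ.flow r z) (ballKernel ℓ x); let et : ℝ → T3 → ℝ := fun r x => empiricalEnergyField (Φ.flow r z) (ballKernel ℓ x); let pt : ℝ → T3 → ℝ := fun r x => hsPressure σ (ρt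 r x) (2 / 3 * (et r x / ρt r x - ‖mt r x‖ ^ 2 / (2 * ρt r x ^ 2))); let MF : ℝ → T3 → ℝ := fun r x => (∑ i, ∑ j, (Torus.partialDeriv i (lamRow θ u r) x) j * (mt r x i * mt r x j / ρt r x)) + pt r x * Torus.divergence (lamRow θ u r) x; let EF : ℝ → T3 → ℝ := fun r x => (et r x + pt r x) * (∑ i, (mt r x i / ρt r x) * (Torus.gradient (lam4Row θ r) x) i); IntervalIntegrable (fun r => (∑ j, (empiricalMomentumField (Φ.flow r z) (fun y => Torus.timeDerivWithin (Set.Icc s (s + τ)) (lamRow θ u) r y j)) j) + ∫ x, MF r x) volume s (s + τ) → (∀ r ∈ Set.Icc s (s + τ), Integrable (fun x => MF r x)) → IntervalIntegrable (fun r => empiricalEnergyField (Φ.flow r z) (Torus.timeDerivWithin (Set.Icc s (s + τ)) (lam4Row θ) r) + ∫ x, EF r x) volume s (s + τ) → (∀ r ∈ Set.Icc s (s + τ), Integrable (fun x => EF r x)) → IntervalIntegrable (fun r => ∫ x, ballRate σ T ρ θ u r ℓ (Φ.flow r z) x) volume s (s + τ) → (∀ r ∈ Set.Icc s (s + τ),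 Integrable (fun x => ballRate σ T ρ θ u r ℓ (Φ.flow r z) x)) → |logProfileObs σ ρ θ u (s + τ) (Φ.flow (s + τ) z) - logProfileObs σ ρ θ u s (Φ.flow s z) - (∫ r in s..(s + τ), ∫ x, ballRate σ T ρ θ u r ℓ (Φ.flow r z) x) - momDefect σ Φ z ℓ s τ (lamRow θ u) - enDefect σ Φ z ℓ s τ (lam4Row θ)| ≤ τ * ω * (4 + 6 * kineticPP z) := by
  intro η₀ F hη₀ hFa hEq σ T hσ ρ θ u hE t ht hband ε n Φ z hz hn s τ hs hτ hst ℓ hℓ0 hℓ ω hω hmod ρt mt et pt MF EF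
    hIM hMF hIE hEF hIB _
  obtain ⟨t', htt', ht'T, hband'⟩ := exists_horizon_of_packing_lt hE hσ ht hband
  obtain ⟨h0, h1, h4⟩ := isSmoothSpaceTimeOn_logProfileRows hη₀ hFa hEq hσ hE ht'T hband'
  have hst' : s + τ < t' := lt_of_le_of_lt hst htt'
  have hsplit : ∀ r ∈ Set.Icc s (s + τ), ∀ x, ballRate σ T ρ θ u r ℓ (Φ.flow r z) x =
      Torus.timeDerivWithin (Set.Ico 0 T) (lam0Row σ ρ θ u) r x *
          empiricalDensityField (Φ.flow r z) (ballKernel ℓ x) +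
        (∑ j, Torus.timeDerivWithin (Set.Ico 0 T) (lamRow θ u) r x j *
          (empiricalMomentumField (Φ.flow r z) (ballKernel ℓ x)) j) +
        Torus.timeDerivWithin (Set.Ico 0 T) (lam4Row θ) r x * empiricalEnergyField (Φ.flow r z) (ballKernel ℓ x) +
        (∑ k, Torus.partialDeriv k (lam0Row σ ρ θ u r) x * (empiricalMomentumField (Φ.flow r z) (ballKernel ℓ x)) k) +
        MF r x + EF r x := by
    intro r hr x
    have hr0 : r ∈ Set.Ico 0 t' := ⟨hs.trans hr.1, hr.2.trans_lt hst'⟩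
    exact wc_entropyRate_split ((h1.isSmooth_slice hr0).isContDiff (by simp))
      ((h4.isSmooth_slice hr0).isContDiff (by simp)) x (ρt r x) (et r x) (mt r x)
  exact wc_core Φ hz hn hs hτ hst' ht'T h0 h1 h4 hℓ0 hℓ hω hmod MF EF hsplit hIM hMF hIE hEF hIB _ _ _ _

end Summit.AtomisticToContinuum.HydrodynamicLimit.Theorems.NearConstantShortTimeHL

end
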